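import Literature.MathematicalPhysics.QuantumFieldTheory.Balaban1983to89.B13Lemma1BlocksTorus
import Literature.MathematicalPhysics.QuantumFieldTheory.Balaban1983to89.B13LeafTorus

/-!
# `Balaban1983to89.B13NodeTorus` — T. Bałaban, *Renormalization group approach to lattice gauge field theories.
II. Cluster expansions*, Commun. Math. Phys. **116** (1988) 1–22, doi:10.1007/bf01239022 [Balaban1988RG2Cluster]:
**the DAG node N10 `Dag.B13_main` («b9 → b10 → b11 → b12 → b13») ON THE TWO-SCALE TORUS FROM LOCATED INPUTS ONLY** —
one theorem composing Lemma 1 with [I]'s block geometry concrete (`B13Lemma1BlocksTorus.lemma1Printed_twoTorus_blocks`),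
Lemma 2 from Lemma 1 (`B13.lemma2_of_lemma1`; (1.43) entered as typed — from (1.39)/(1.40) it is
`B13Bound143.bound143_of_oneShot`), Lemma 3 = (2.38) on the torus from (2.26) and numbers (`B13Lemma3Torus.bound238_torus`), and the knit
`B13LeafTorus.b13_main_twoTorus`

statement-level skeleton of published theorems with citation tags; proofs where landed; nothing here is a claim about
the Yang–Mills mass gap

PDF held: `paper:balaban1988-cmp116-rg-ii-cluster` (journal page = PDF page + 0); pp. 7–9, 11, 20 re-read this session.

CITATION HEADER / WHAT IS REPRODUCED (cell `pub-ymgap`, Track A node N10 = [B13], prover seat `pub-ymgap-dag-p2`, twelfth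
module; a NEW LEAF over `B13Lemma1BlocksTorus` and `B13LeafTorus`, nothing there modified).  TWO THEOREMS:
`b13_main_twoTorus_located` (Lemma 3 entered AS TYPED: `h238 : Bound238`) and `b13_main_twoTorus_located_of_226` ((2.38)
from the (2.26)-majorant and numbers via `B13Lemma3Torus.bound238_torus`).  THEIR HYPOTHESIS LIST IS THE LIST OF WHAT A
NODE-00 PIN OF THE B13 GROUP MUST CARRY FOR N10 (D-0059 route stub
`stub_N10_B13 : Dag.B13_main`, Stage 4): (0) the binding of record `w.up P = ofPrintedAllXPN X Y Z V W′` with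
`X.S13 = Wt.toStepData`, `X.c13 = c` for a two-scale torus step datum `Wt : TwoTorusStep 4 L N′` (L·N′ ≥ 12, c.L = L);
(1) LEMMA 1 inputs (pp. 7–9): the decomposition (1.33) with its structural index data ([I]'s □₀ ⊂ Y, Y₀∖□̃⁴ ⊂ □₀∖□̃⁴,
□′ ⊂ □̃², X ∋ □′, X₀ ⊆ Y, □ ⊂ Y, δ₀·dist^{(ξ)} ≥ δ₀M(n + 1) at gap ≥ n + 1 cubes), per-term analyticity + closure of `Analytic`, the
per-term bounds (1.24)/(1.30) VERBATIM (by reference to (I.3.54), (I.3.17), [15] Prop. 4, [13] (3.108)), thresholds,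
R8, R9, the constants C₁, C₂, q; (2) LEMMA 2 inputs (pp. 10–11): V″_k := V′_k, (1.42), (1.43) (as typed; from the
(1.39)/(1.40) product it is `B13Bound143.bound143_of_oneShot` under its floor), analyticity of V_k, gauge invariance (by
assertion, cell GAPS G-B13-06); (3) LEMMA 3 inputs (pp. 14–20): the (2.26)-majorant `hrep` over the torus index sets and the restrictions
R15–R20/(2.31) as numbers (`B13Lemma3Torus.bound238_torus`, every geometric input of Lemma 3 discharged there).
EVERYTHING geometric/combinatorial of pp. 7–9 and pp. 17–20 is a theorem of the torus.  Nothing is discharged about the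
node itself: the B13 group is FREE at NODE 00 Stages 1–3 (`Node00.CarriersFrame.carriers₁_groupB13`).
HONEST FRAMING: a count-neutral Track-A side landing (YM-PLAN §1); NOT a discharge of node N10; one finite T⁴ programme
at fixed ε; Bałaban AS PRINTED with page locators; nothing continuum / OS / mass-gap / Clay.
-/

noncomputable section

namespace Literature.MathematicalPhysics.QuantumFieldTheory.Balaban1983to89.B13NodeTorus

open Literature.MathematicalPhysics.QuantumFieldTheory.Balaban1983to89
open Literature.MathematicalPhysics.QuantumFieldTheory.Balaban1983to89.B13ScaleTransfer (Pt)
open Literature.MathematicalPhysics.QuantumFieldTheory.Balaban1983to89.B16Absorption (pbox)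
open Literature.MathematicalPhysics.QuantumFieldTheory.Balaban1983to89.TreeLengthTorus
open Literature.MathematicalPhysics.QuantumFieldTheory.Balaban1983to89.TreeLengthTorusGeometry
open Literature.MathematicalPhysics.QuantumFieldTheory.Balaban1983to89.TreeLengthTorusTransfer (tcoarse tclosureDom)
open Literature.MathematicalPhysics.QuantumFieldTheory.Balaban1983to89.B12TreeDecay (kappa₀ K₀)
open Literature.MathematicalPhysics.QuantumFieldTheory.Balaban1983to89.B13Lemma3TorusData
open Literature.MathematicalPhysics.QuantumFieldTheory.Balaban1983to89.B13Lemma3Assembly (innerSum compSum famSum)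
open Literature.MathematicalPhysics.QuantumFieldTheory.Balaban1983to89.B13Lemma3Torus
  (TwoTorusStep J I wZ cc bound238_torus)
open Literature.MathematicalPhysics.QuantumFieldTheory.Balaban1983to89.DagBinding
open Literature.MathematicalPhysics.QuantumFieldTheory.Balaban1983to89.B13Lemma1BlocksTorus (lemma1Printed_twoTorus_blocks)
open Literature.MathematicalPhysics.QuantumFieldTheory.Balaban1983to89.B13LeafTorus (b13_main_twoTorus)

section Torus

variable {L N' : ℕ} [NeZero L] [NeZero N']

/-- **N10 ON THE TWO-SCALE TORUS FROM THE LOCATED INPUTS OF LEMMAS 1–2 AND (2.38).**  For every binding of record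
`w.up P = Upstream.ofPrintedAllXPN X Y Z V W′` whose B13 group is the two-scale torus step datum and constants
`(Wt.toStepData, c)` (`hS`, `hc`; L·N′ ≥ 12, L ≥ 2): the inputs of Lemma 1
(`B13Lemma1BlocksTorus.lemma1Printed_twoTorus_blocks`: (1.33) + structural index data + per-term (1.24)/(1.30)/
analyticity + thresholds + R8/R9 + constants), of Lemma 2 (V″_k := V′_k, (1.42), (1.43), analyticity, gauge
invariance) and the bound (2.38) under the restrictions (`h238` — Lemma 3 AS TYPED; on the torus it is
`B13Lemma3Torus.bound238_torus` from the (2.26)-majorant and numbers: version `b13_main_twoTorus_located_of_226`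
below) give `Dag.B13_main (leavesP w P)` — the leaves b9, b10, b11, b12 entering through the per-term inputs, not
through the typed antecedents (`B13LeafTorus.b13_main_iff_leaf`).  The non-binding hypotheses of this theorem are
jointly satisfiable (`B13Lemma1BlocksTorusNonvacuity.blocks_leaf_nonvacuous`). [cite: Balaban1988RG2Cluster, Lemmas 1–3 pp.7–20] -/
theorem b13_main_twoTorus_located
    -- (0) the binding of record and the B13 group
    (w : WorldP) (P : B12.RunParams) (X : PrintedCarriersR) (Y9 : PrintedCarriers9X) (Z11 : PrintedCarriers11)
    (V14 : PrintedCarriers14R) (W15 : PrintedCarriers15) (hP : w.up P = Upstream.ofPrintedAllXPN X Y9 Z11 V14 W15)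
    (Wt : TwoTorusStep 4 L N') (c : B13.Consts) (hS : X.S13 = Wt.toStepData) (hc : X.c13 = c)
    (k : ℕ) (hN12 : 12 ≤ L * N') (hL2 : 2 ≤ L)
    -- (1) LEMMA 1: index data of (1.33)
    (S0 : TDom 4 (L * N') → Finset (TPt 4 (L * N')))
    (F : TDom 4 (L * N') → TPt 4 (L * N') → Finset (TPt 4 (L * N')))
    (Sq : TDom 4 (L * N') → TPt 4 (L * N') → (j : ℕ) → Finset (TPt 4 (L ^ (k - j) * (L * N'))))
    (SX : TDom 4 (L * N') → TPt 4 (L * N') → (j : ℕ) → TPt 4 (L ^ (k - j) * (L * N')) →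
      Finset (TDom 4 (L ^ (k - j) * (L * N'))))
    (T : TDom 4 (L * N') → TPt 4 (L * N') → Finset (TPt 4 (L * N')) → (j : ℕ) →
      TPt 4 (L ^ (k - j) * (L * N')) → TDom 4 (L ^ (k - j) * (L * N')) → Wt.Φ → ℂ)
    (Sc : TDom 4 (L * N') → Finset (TPt 4 (L * N')))
    (Sq' : TDom 4 (L * N') → TPt 4 (L * N') → (j : ℕ) → Finset (TPt 4 (L ^ (k - j) * (L * N'))))
    (SX' : TDom 4 (L * N') → TPt 4 (L * N') → (j : ℕ) → TPt 4 (L ^ (k - j) * (L * N')) →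
      Finset (TDom 4 (L ^ (k - j) * (L * N'))))
    (T' : TDom 4 (L * N') → TPt 4 (L * N') → (j : ℕ) → TPt 4 (L ^ (k - j) * (L * N')) →
      TDom 4 (L ^ (k - j) * (L * N')) → Wt.Φ → ℂ)
    (dist : TDom 4 (L * N') → TPt 4 (L * N') → (j : ℕ) → TPt 4 (L ^ (k - j) * (L * N')) → ℝ) {K K' : ℝ}
    (h133 : ∀ Y, Wt.Vp Y =
      (∑ a ∈ S0 Y, ∑ X ∈ (F Y a).powerset, ∑ j ∈ Finset.range (k + 1), ∑ q ∈ Sq Y a j,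
        ∑ x ∈ SX Y a j q, T Y a X j q x) +
      (∑ a ∈ Sc Y, ∑ j ∈ Finset.range (k + 1), ∑ q ∈ Sq' Y a j, ∑ x ∈ SX' Y a j q, T' Y a j q x))
    (hS0Y : ∀ Y, ∀ a ∈ S0 Y,
      (pbox (fun i => natLift a i - (5 : ℕ)) (fun i => natLift a i + 1 + (5 : ℕ))).image (proj (L * N')) ⊆ Y.1)
    (hFsub : ∀ Y a, F Y a ⊆
      (pbox (fun i => natLift a i - (5 : ℕ)) (fun i => natLift a i + 1 + (5 : ℕ))).image (proj (L * N')) \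
        (pbox (fun i => natLift a i - (4 : ℕ)) (fun i => natLift a i + 1 + (4 : ℕ))).image (proj (L * N')))
    (hSq : ∀ Y, ∀ a ∈ S0 Y, ∀ j, Sq Y a j ⊆ (Finset.univ : Finset (TPt 4 (L ^ (k - j) * (L * N')))).filter
      (fun q => tcoarse (L ^ (k - j)) (L * N') q ∈
        (pbox (fun i => natLift a i - (2 : ℕ)) (fun i => natLift a i + 1 + (2 : ℕ))).image (proj (L * N'))))
    (hScY : ∀ Y, Sc Y ⊆ Y.1)
    (hdist0 : ∀ Y a j q, 0 ≤ c.δ₀ * dist Y a j q)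
    (hdist : ∀ Y a j (n : ℕ) q, q ∉ (pbox (fun i => ((L ^ (k - j) : ℕ) : ℤ) * natLift a i - (n + 1 : ℕ))
      (fun i => ((L ^ (k - j) : ℕ) : ℤ) * natLift a i + 2 * ((L ^ (k - j) : ℕ) : ℤ) - 1 + (n + 1 : ℕ))).image
        (proj (L ^ (k - j) * (L * N'))) → c.δ₀ * c.M * ((n : ℝ) + 1) ≤ c.δ₀ * dist Y a j q)
    (hSX : ∀ Y a j q, SX Y a j q ⊆ (tcubeSys 4 (L ^ (k - j) * (L * N'))).above q)
    (hSX' : ∀ Y a j q, SX' Y a j q ⊆ (tcubeSys 4 (L ^ (k - j) * (L * N'))).above q)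
    (hX0 : ∀ Y, ∀ a ∈ Sc Y, ∀ j ∈ Finset.range (k + 1), ∀ q ∈ Sq' Y a j, ∀ x ∈ SX' Y a j q,
      x.1.image (tcoarse (L ^ (k - j)) (L * N')) ⊆ Y.1)
    -- (1) LEMMA 1: analyticity of the terms, closure of `Analytic`
    (hAdd : ∀ (s : Set Wt.Φ) (f g : Wt.Φ → ℂ), Wt.Analytic f s → Wt.Analytic g s → Wt.Analytic (f + g) s)
    (hZero : ∀ s : Set Wt.Φ, Wt.Analytic 0 s)
    (hAnT : ∀ Y, ∀ a ∈ S0 Y, ∀ X ∈ (F Y a).powerset, ∀ j ∈ Finset.range (k + 1), ∀ q ∈ Sq Y a j,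
      ∀ x ∈ SX Y a j q, Wt.Analytic (T Y a X j q x) (Wt.sp1 Y))
    (hAnT' : ∀ Y, ∀ a ∈ Sc Y, ∀ j ∈ Finset.range (k + 1), ∀ q ∈ Sq' Y a j, ∀ x ∈ SX' Y a j q,
      Wt.Analytic (T' Y a j q x) (Wt.sp1 Y))
    -- (1) LEMMA 1: thresholds and restrictions
    (hK : 0 ≤ K) (hK' : 0 ≤ K') (hκ : 0 ≤ c.κ) (hδ1 : c.δ < 1) (hδκ : 1 ≤ c.δ * c.κ)
    (hκ126 : kappa₀ 64 8 ≤ c.κ) (hκ126' : kappa₀ 64 8 ≤ c.δ * c.κ)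
    (hκ₁ : 1 + 2 * Real.log (8 * 12 ^ 3) ≤ c.κ₁) (hκ₁' : 2 + 16 * Real.log 128 ≤ c.κ₁)
    (hδ₀M : 10 * Real.exp (-1) ≤ c.δ₀ * c.M) (hδ₀M5 : 2 * Real.log 5 ≤ c.δ₀ * c.M)
    (hR8 : (1 - c.δ) * c.κ ≤ (1 / 4) * (c.κ₁ - 1)) (hR9 : (1 - 2 * c.δ) * c.κ ≤ (1 / 16) * c.κ₁)
    -- (1) LEMMA 1: per-term (1.24), (1.30), the constants of (1.36)
    (h124 : ∀ Y φ, φ ∈ Wt.sp1 Y → ∀ a ∈ S0 Y, ∀ X ∈ (F Y a).powerset, ∀ j ∈ Finset.range (k + 1), ∀ q ∈ Sq Y a j,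
      ∀ x ∈ SX Y a j q,
        ‖T Y a X j q x φ‖ ≤ K * ((L : ℝ) ^ j * ((L : ℝ) ^ k)⁻¹) ^ 5 *
          Real.exp (-(c.κ₁ - 1) *
            (((Y.1 \ (pbox (fun i => natLift a i - (5 : ℕ)) (fun i => natLift a i + 1 + (5 : ℕ))).image
              (proj (L * N'))).card : ℝ) + X.card)) *
          Real.exp (-(c.κ * torusTreeLen x.1)))
    (h130 : ∀ Y φ, φ ∈ Wt.sp1 Y → ∀ a ∈ Sc Y, ∀ j ∈ Finset.range (k + 1), ∀ q ∈ Sq' Y a j,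
      ∀ x ∈ SX' Y a j q,
        ‖T' Y a j q x φ‖ ≤ K' * Real.exp (-(1 / 2) * (c.δ₀ * c.M) * ((L : ℝ) ^ j * ((L : ℝ) ^ k)⁻¹)⁻¹
            - (1 / 2) * c.δ₀ * dist Y a j q) *
          Real.exp (-(c.κ₁ - 1) * ((Y.1 \ x.1.image (tcoarse (L ^ (k - j)) (L * N'))).card : ℝ)) *
          Real.exp (-(c.κ * torusTreeLen x.1)))
    (hC : K * K₀ 64 8 * (2 * (6 * (L : ℝ)) ^ 4) * Real.exp 1 * Real.exp ((1 / 8) * c.κ₁ * (12 ^ 4 - 1)) +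
        2 * (64 * K') * K₀ 64 8 * 1344 ≤
      c.E₀ * c.ε₁ * c.C₁ * c.M ^ c.q * Real.exp (c.C₂ * c.κ₁))
    -- (2) LEMMA 2 (pp. 10–11): V″_k := V′_k, (1.42), (1.43), analyticity, gauge invariance
    (hVpp : Wt.Vpp = Wt.Vp) (hrepr : B13.Repr142 Wt.toStepData) (h143 : B13.Bound143 Wt.toStepData c)
    (hVan : ∀ Y, Wt.Analytic (Wt.V Y) (Wt.sp1 Y))
    (hG : ∀ Y, Wt.GaugeInv (Wt.V Y) ∧ Wt.GaugeInv (Wt.toStepData.quadForm Y) ∧ Wt.GaugeInv (Wt.Vpp Y))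
    -- (3) LEMMA 3 as typed: (2.38) under the restrictions
    (h238 : B13.Bound238 Wt.toStepData c) :
    Dag.B13_main (leavesP w P) := by
  -- Lemma 1 with [I]'s block geometry concrete
  have h1 : B13.Lemma1Printed Wt.toStepData c :=
    lemma1Printed_twoTorus_blocks Wt c k hN12 S0 F Sq SX T Sc Sq' SX' T' dist h133 hS0Y hFsub hSq hScY hdist0 hdist
      hSX hSX' hX0 hAdd hZero hAnT hAnT' hK hK' hL2 hκ hδ1 hδκ hκ126 hκ126' hκ₁ hκ₁' hδ₀M hδ₀M5 hR8 hR9 h124 h130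
      hC
  exact b13_main_twoTorus w P X Y9 Z11 V14 W15 hP Wt c hS hc h1 hVpp hrepr h143 hVan hG h238

open Classical in
/-- **N10 ON THE TWO-SCALE TORUS FROM LOCATED INPUTS ONLY, (2.38) FROM (2.26) AND NUMBERS.**  For every binding of record
`w.up P = Upstream.ofPrintedAllXPN X Y Z V W′` whose B13 group is the two-scale torus step datum and constants
`(Wt.toStepData, c)` (`hS`, `hc`; L·N′ ≥ 12, c.L = L ≥ 8): the inputs of Lemma 1 (`B13Lemma1BlocksTorus.lemma1Printed_twoTorus_blocks`:
(1.33) + structural index data + per-term (1.24)/(1.30)/analyticity + thresholds + R8/R9 + constants), of Lemma 2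
(V″_k := V′_k, (1.42), (1.43), analyticity, gauge invariance) and of Lemma 3 (`B13Lemma3Torus.bound238_torus`: the (2.26)-majorant `hrep` and the restrictions as numbers) give
`Dag.B13_main (leavesP w P)` — the leaves b9, b10, b11, b12 entering through the per-term inputs, not through the typed
antecedents (`B13LeafTorus.b13_main_iff_leaf`). [cite: Balaban1988RG2Cluster, Lemmas 1–3 pp.7–20] -/
theorem b13_main_twoTorus_located_of_226
    -- (0) the binding of record and the B13 group
    (w : WorldP) (P : B12.RunParams) (X : PrintedCarriersR) (Y9 : PrintedCarriers9X) (Z11 : PrintedCarriers11)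
    (V14 : PrintedCarriers14R) (W15 : PrintedCarriers15) (hP : w.up P = Upstream.ofPrintedAllXPN X Y9 Z11 V14 W15)
    (Wt : TwoTorusStep 4 L N') (c : B13.Consts) (hS : X.S13 = Wt.toStepData) (hc : X.c13 = c)
    (k : ℕ) (hN12 : 12 ≤ L * N') (hL8 : 8 ≤ c.L) (hLc : c.L = L)
    -- (1) LEMMA 1: index data of (1.33)
    (S0 : TDom 4 (L * N') → Finset (TPt 4 (L * N')))
    (F : TDom 4 (L * N') → TPt 4 (L * N') → Finset (TPt 4 (L * N')))
    (Sq : TDom 4 (L * N') → TPt 4 (L * N') → (j : ℕ) → Finset (TPt 4 (L ^ (k - j) * (L * N'))))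
    (SX : TDom 4 (L * N') → TPt 4 (L * N') → (j : ℕ) → TPt 4 (L ^ (k - j) * (L * N')) →
      Finset (TDom 4 (L ^ (k - j) * (L * N'))))
    (T : TDom 4 (L * N') → TPt 4 (L * N') → Finset (TPt 4 (L * N')) → (j : ℕ) →
      TPt 4 (L ^ (k - j) * (L * N')) → TDom 4 (L ^ (k - j) * (L * N')) → Wt.Φ → ℂ)
    (Sc : TDom 4 (L * N') → Finset (TPt 4 (L * N')))
    (Sq' : TDom 4 (L * N') → TPt 4 (L * N') → (j : ℕ) → Finset (TPt 4 (L ^ (k - j) * (L * N'))))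
    (SX' : TDom 4 (L * N') → TPt 4 (L * N') → (j : ℕ) → TPt 4 (L ^ (k - j) * (L * N')) →
      Finset (TDom 4 (L ^ (k - j) * (L * N'))))
    (T' : TDom 4 (L * N') → TPt 4 (L * N') → (j : ℕ) → TPt 4 (L ^ (k - j) * (L * N')) →
      TDom 4 (L ^ (k - j) * (L * N')) → Wt.Φ → ℂ)
    (dist : TDom 4 (L * N') → TPt 4 (L * N') → (j : ℕ) → TPt 4 (L ^ (k - j) * (L * N')) → ℝ) {K K' : ℝ}
    (h133 : ∀ Y, Wt.Vp Y =
      (∑ a ∈ S0 Y, ∑ X ∈ (F Y a).powerset, ∑ j ∈ Finset.range (k + 1), ∑ q ∈ Sq Y a j,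
        ∑ x ∈ SX Y a j q, T Y a X j q x) +
      (∑ a ∈ Sc Y, ∑ j ∈ Finset.range (k + 1), ∑ q ∈ Sq' Y a j, ∑ x ∈ SX' Y a j q, T' Y a j q x))
    (hS0Y : ∀ Y, ∀ a ∈ S0 Y,
      (pbox (fun i => natLift a i - (5 : ℕ)) (fun i => natLift a i + 1 + (5 : ℕ))).image (proj (L * N')) ⊆ Y.1)
    (hFsub : ∀ Y a, F Y a ⊆
      (pbox (fun i => natLift a i - (5 : ℕ)) (fun i => natLift a i + 1 + (5 : ℕ))).image (proj (L * N')) \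
        (pbox (fun i => natLift a i - (4 : ℕ)) (fun i => natLift a i + 1 + (4 : ℕ))).image (proj (L * N')))
    (hSq : ∀ Y, ∀ a ∈ S0 Y, ∀ j, Sq Y a j ⊆ (Finset.univ : Finset (TPt 4 (L ^ (k - j) * (L * N')))).filter
      (fun q => tcoarse (L ^ (k - j)) (L * N') q ∈
        (pbox (fun i => natLift a i - (2 : ℕ)) (fun i => natLift a i + 1 + (2 : ℕ))).image (proj (L * N'))))
    (hScY : ∀ Y, Sc Y ⊆ Y.1)
    (hdist0 : ∀ Y a j q, 0 ≤ c.δ₀ * dist Y a j q)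
    (hdist : ∀ Y a j (n : ℕ) q, q ∉ (pbox (fun i => ((L ^ (k - j) : ℕ) : ℤ) * natLift a i - (n + 1 : ℕ))
      (fun i => ((L ^ (k - j) : ℕ) : ℤ) * natLift a i + 2 * ((L ^ (k - j) : ℕ) : ℤ) - 1 + (n + 1 : ℕ))).image
        (proj (L ^ (k - j) * (L * N'))) → c.δ₀ * c.M * ((n : ℝ) + 1) ≤ c.δ₀ * dist Y a j q)
    (hSX : ∀ Y a j q, SX Y a j q ⊆ (tcubeSys 4 (L ^ (k - j) * (L * N'))).above q)
    (hSX' : ∀ Y a j q, SX' Y a j q ⊆ (tcubeSys 4 (L ^ (k - j) * (L * N'))).above q)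
    (hX0 : ∀ Y, ∀ a ∈ Sc Y, ∀ j ∈ Finset.range (k + 1), ∀ q ∈ Sq' Y a j, ∀ x ∈ SX' Y a j q,
      x.1.image (tcoarse (L ^ (k - j)) (L * N')) ⊆ Y.1)
    -- (1) LEMMA 1: analyticity of the terms, closure of `Analytic`
    (hAdd : ∀ (s : Set Wt.Φ) (f g : Wt.Φ → ℂ), Wt.Analytic f s → Wt.Analytic g s → Wt.Analytic (f + g) s)
    (hZero : ∀ s : Set Wt.Φ, Wt.Analytic 0 s)
    (hAnT : ∀ Y, ∀ a ∈ S0 Y, ∀ X ∈ (F Y a).powerset, ∀ j ∈ Finset.range (k + 1), ∀ q ∈ Sq Y a j,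
      ∀ x ∈ SX Y a j q, Wt.Analytic (T Y a X j q x) (Wt.sp1 Y))
    (hAnT' : ∀ Y, ∀ a ∈ Sc Y, ∀ j ∈ Finset.range (k + 1), ∀ q ∈ Sq' Y a j, ∀ x ∈ SX' Y a j q,
      Wt.Analytic (T' Y a j q x) (Wt.sp1 Y))
    -- (1) LEMMA 1: thresholds and restrictions
    (hK : 0 ≤ K) (hK' : 0 ≤ K') (hκ : 0 ≤ c.κ) (hδ1 : c.δ < 1) (hδκ : 1 ≤ c.δ * c.κ)
    (hκ126 : kappa₀ 64 8 ≤ c.κ) (hκ126' : kappa₀ 64 8 ≤ c.δ * c.κ)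
    (hκ₁ : 1 + 2 * Real.log (8 * 12 ^ 3) ≤ c.κ₁) (hκ₁' : 2 + 16 * Real.log 128 ≤ c.κ₁)
    (hδ₀M : 10 * Real.exp (-1) ≤ c.δ₀ * c.M) (hδ₀M5 : 2 * Real.log 5 ≤ c.δ₀ * c.M)
    (hR8 : (1 - c.δ) * c.κ ≤ (1 / 4) * (c.κ₁ - 1)) (hR9 : (1 - 2 * c.δ) * c.κ ≤ (1 / 16) * c.κ₁)
    -- (1) LEMMA 1: per-term (1.24), (1.30), the constants of (1.36)
    (h124 : ∀ Y φ, φ ∈ Wt.sp1 Y → ∀ a ∈ S0 Y, ∀ X ∈ (F Y a).powerset, ∀ j ∈ Finset.range (k + 1), ∀ q ∈ Sq Y a j,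
      ∀ x ∈ SX Y a j q,
        ‖T Y a X j q x φ‖ ≤ K * ((L : ℝ) ^ j * ((L : ℝ) ^ k)⁻¹) ^ 5 *
          Real.exp (-(c.κ₁ - 1) *
            (((Y.1 \ (pbox (fun i => natLift a i - (5 : ℕ)) (fun i => natLift a i + 1 + (5 : ℕ))).image
              (proj (L * N'))).card : ℝ) + X.card)) *
          Real.exp (-(c.κ * torusTreeLen x.1)))
    (h130 : ∀ Y φ, φ ∈ Wt.sp1 Y → ∀ a ∈ Sc Y, ∀ j ∈ Finset.range (k + 1), ∀ q ∈ Sq' Y a j,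
      ∀ x ∈ SX' Y a j q,
        ‖T' Y a j q x φ‖ ≤ K' * Real.exp (-(1 / 2) * (c.δ₀ * c.M) * ((L : ℝ) ^ j * ((L : ℝ) ^ k)⁻¹)⁻¹
            - (1 / 2) * c.δ₀ * dist Y a j q) *
          Real.exp (-(c.κ₁ - 1) * ((Y.1 \ x.1.image (tcoarse (L ^ (k - j)) (L * N'))).card : ℝ)) *
          Real.exp (-(c.κ * torusTreeLen x.1)))
    (hC : K * K₀ 64 8 * (2 * (6 * (L : ℝ)) ^ 4) * Real.exp 1 * Real.exp ((1 / 8) * c.κ₁ * (12 ^ 4 - 1)) +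
        2 * (64 * K') * K₀ 64 8 * 1344 ≤
      c.E₀ * c.ε₁ * c.C₁ * c.M ^ c.q * Real.exp (c.C₂ * c.κ₁))
    -- (2) LEMMA 2 (pp. 10–11): V″_k := V′_k, (1.42), (1.43), analyticity, gauge invariance
    (hVpp : Wt.Vpp = Wt.Vp) (hrepr : B13.Repr142 Wt.toStepData) (h143 : B13.Bound143 Wt.toStepData c)
    (hVan : ∀ Y, Wt.Analytic (Wt.V Y) (Wt.sp1 Y))
    (hG : ∀ Y, Wt.GaugeInv (Wt.V Y) ∧ Wt.GaugeInv (Wt.toStepData.quadForm Y) ∧ Wt.GaugeInv (Wt.Vpp Y))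
    -- (3) LEMMA 3 (pp. 14–20): the (2.26)-majorant and the restrictions as numbers
    (M3 : ℕ) [NeZero M3] {a3 a₂ a₂' a₅ Aabs : ℝ}
    (hrep : ∀ (Zd : TDom 4 N') (φ : Wt.Φ), φ ∈ Wt.sp2 Zd → ‖Wt.H Zd φ‖ ≤
      Real.exp (a₅ * ((Zd.1).card : ℝ)) *
      ∑ j : J Zd, Real.exp (-((c.κ₁ - 1) * ((wZ Zd j).card : ℝ))) *
        ∏ i : I Zd j, famSum (B13FamilySum.coveringFamilies (Finset.univ : Finset (TDom 4 N'))
            (fun Z' : TDom 4 N' => Z'.1) (cc Zd j i))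
          (fun Z' => compSum (Finset.univ.filter fun Zc : TDom 4 (L * N') => tclosureDom L N' Zc = Z')
            (fun Zc => innerSum (Finset.univ : Finset (TDom 4 (L * N'))) (fun Y : TDom 4 (L * N') => Y.1)
              (tsys 4 (L * N')).dj Zc.1 (ttouch M3 (L * N')) (tavail M3 (L * N') Zc)
              (c.α₆ * c.eps2) ((1 - 3 * c.δ) * c.κ) a3)))
    (hα₆ : 0 < c.α₆) (hε₀ : 0 ≤ c.eps2) (hδ : 0 ≤ c.δ) (hδ7 : 0 ≤ 1 - 7 * c.δ) (ha3 : 0 ≤ a3)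
    (hR15 : c.R15) (hR16 : 18 * ((1 - 4 * c.δ) * c.κ) ≤ a3 / 20) (hR16' : 4 * c.κ ≤ a3 / 20)
    (hR17 : Real.exp (-(a3 / 20)) ≤ c.eps2) (h231 : 2 * (4 : ℝ) * (M3 : ℝ) ^ 4 * Real.exp (-(a3 / 10)) ≤ a3 / 20)
    (ha₂ : 0 ≤ a₂) (hκ229 : kappa₀ 64 8 + a₂ ≤ c.δ * c.κ)
    (hsm229 : c.α₆ * Real.exp a₂ * K₀ 64 8 * 64 ≤ a₂)
    (habsk : Real.exp (-(a3 / 20)) * 64 ≤ c.δ * c.κ)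
    (h18half : B13Step237.R18half c (K₀ 64 8 * Real.exp (Real.exp (-(a3 / 20)) * 64)))
    (h18 : B13Step237.R18sharp c (K₀ 64 8 * Real.exp (Real.exp (-(a3 / 20)) * 64)) ((c.L : ℝ) / 2))
    (ha₂' : 0 ≤ a₂') (hκ229' : kappa₀ 64 8 + a₂' ≤ c.δ * ((c.L : ℝ) / 2) * c.κ)
    (hsm229' : c.α₆ * Real.exp a₂' * K₀ 64 8 * 64 ≤ a₂')
    (hR20 : 18 * ((1 - 7 * c.δ) * ((c.L : ℝ) / 2) * c.κ) ≤ (c.κ₁ - 1) / 2)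
    (ha₅ : 0 ≤ a₅) (habs : a₅ + Real.exp (-((c.κ₁ - 1) / 2)) ≤ Aabs)
    (hAc : Aabs * 64 ≤ c.δ * ((c.L : ℝ) / 2) * c.κ)
    (hC3 : B13Step237.bracketF c (K₀ 64 8 * Real.exp (Real.exp (-(a3 / 20)) * 64)) / c.α₆ *
      Real.exp (Aabs * 64) ≤ c.C3act * c.ε₁) :
    Dag.B13_main (leavesP w P) := by
  have hL2 : 2 ≤ L := by omega
  -- (2.38) on the torus from (2.26) and numbers
  have h238 : B13.Bound238 Wt.toStepData c :=
    bound238_torus c hL8 hLc Wt M3 hrep hα₆ hε₀ hδ hδ7 hκ ha3 hR15 hR16 hR16' hR17 h231 ha₂ hκ229 hsm229 habsk h18half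
      h18 ha₂' hκ229' hsm229' hR20 ha₅ habs hAc hC3
  exact b13_main_twoTorus_located w P X Y9 Z11 V14 W15 hP Wt c hS hc k hN12 hL2 S0 F Sq SX T Sc Sq' SX' T' dist h133
    hS0Y hFsub hSq hScY hdist0 hdist hSX hSX' hX0 hAdd hZero hAnT hAnT' hK hK' hκ hδ1 hδκ hκ126 hκ126' hκ₁ hκ₁' hδ₀M
    hδ₀M5 hR8 hR9 h124 h130 hC hVpp hrepr h143 hVan hG h238

end Torus

end Literature.MathematicalPhysics.QuantumFieldTheory.Balaban1983to89.B13NodeTorus
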